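import Mathlib
import Summits.ResolutionOfSingularities.ResolutionOfSingularities.Theorems.HomologicalConductorPersistenceCyclicTransferGeneral
import HarnessLib

/-!
# Crux `Persistence` (stmt-16484) / rung S-2 `PersistenceSurface` (stmt-19970) — cyclic transfer, part 3:
# CA-LAYER FORMS of the isotypic averaging lemma (chain W4.4b, seat res-L1-w44b-stub-4 gen 4)

[OURS · L1 w44b · Σ6 / C4 class] Nothing here is a statement of the manuscript under review (Hironaka 2017);
AI-written, weaker than expert review.  The free-factorisation theorems of part 2
(`…PersistenceCyclicTransferGeneral`) in the vocabulary `StablyAnnihilates T x M` of the CA layer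
(`…NoZenoStableAnnihilatorReduction`), via the bridge `stablyAnnihilates_iff_exists_linearMap`.

* `StablyAnnihilates.fixed_of_isotypic` — `c ∈ s̲ann_V(M)` of character `ω^γ`, `a ∈ 𝔞_γ` (isotypic product
  ideal, given by decompositions `a = ∑_k b_k b'_k` for each `j mod d`) ⟹ `a c ∈ s̲ann_U(M^τ)`  (planner's T-V).
* `StablyAnnihilates.fixed_of_cyclic` — `σ c = ω c`, `σ aᵢ = ω aᵢ` ⟹ `c a₀⋯a_{d-2} ∈ s̲ann_U(M^τ)`.
* `StablyAnnihilates.fixed_pow_of_cyclic`, `StablyAnnihilates.fixed_pow_of_isPrimitiveRoot` — the pure-power rule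
  «`σ w = ω w`, `w ∈ s̲ann_V(M)` ⟹ `w^d ∈ s̲ann_U(M^τ)`», the second with `ω` a primitive `d`-th root of unity in
  a domain `U` (the user-facing form at the Σ6 / C4 arrivals `U = V^{μ_d}`, `x = w^d`).

DIMENSION CAVEAT (CHAIN Q13-3): dimension-free algebra; the INPUT «every high-syzygy `U`-module is `M^τ` with `c`
stably zero on `M`» is 2-dimensional (Auslander) and fails in dimension 3 (K-C3).

References: Iyengar–Takahashi, IMRN 2016, arXiv:1404.1476, Remark 2.13 [`IyengarTakahashi2014`]; folklore.
-/

-- single-problem summit: the doubled namespace component `ResolutionOfSingularities` is forced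
set_option linter.dupNamespace false

noncomputable section

open CategoryTheory Literature.RingTheory.CohomologyAnnihilator
open Summit.ResolutionOfSingularities.ResolutionOfSingularities.Theorems.NoZeno.SandwichCluster
open Summit.ResolutionOfSingularities.ResolutionOfSingularities.Theorems.HomologicalConductor.PersistenceSurfaceHullCover
open Summit.ResolutionOfSingularities.ResolutionOfSingularities.Theorems.HomologicalConductor.PersistenceCyclicTransferFamily
open Summit.ResolutionOfSingularities.ResolutionOfSingularities.Theorems.HomologicalConductor.PersistenceCyclicTransferGeneral

universe u

namespace Summit.ResolutionOfSingularities.ResolutionOfSingularities.Theorems.HomologicalConductor.PersistenceCyclicTransferStable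

variable {U V : Type u} [CommRing U] [CommRing V] [Algebra U V]
variable {M : Type u} [AddCommGroup M] [Module V M] [Module U M] [IsScalarTower U V M]
variable {N : Type u} [AddCommGroup N] [Module U N]

/-- **Isotypic averaging, CA-layer form** (T-V): `c` of character `ω^γ` stably annihilates the `V`-module `M`,
`a ∈ 𝔞_γ = ⋂_j V_{[j]}V_{[-γ-j]}` (given by decompositions), `algebraMap U V u = a * c` ⟹ `u` stably
annihilates the invariant `U`-module `N ≅ M^τ`. [folklore] -/
theorem StablyAnnihilates.fixed_of_isotypic (σ : V →ₐ[U] V) {d : ℕ} (hd : 0 < d) (hσd : σ ^ d = 1)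
    (hfix : ∀ v : V, σ v = v → ∃ u : U, algebraMap U V u = v) (hinj : Function.Injective (algebraMap U V))
    (ω : U) (hωd : ω ^ d = 1) (horth : ∀ m : ℕ, ¬ d ∣ m → ∑ i ∈ Finset.range d, ω ^ (m * i) = 0)
    (hdU : IsUnit ((d : ℕ) : U)) (τ : M →+ M) (hτ : ∀ (v : V) (m : M), τ (v • m) = σ v • τ m)
    (hτd : ∀ m, (⇑τ)^[d] m = m) (j : N →ₗ[U] M) (hjinj : Function.Injective j) (hjτ : ∀ n, τ (j n) = j n)
    (hjsurj : ∀ m, τ m = m → ∃ n, j n = m) {c : V} (gc : ℕ) (hc : σ c = algebraMap U V ω ^ gc * c) {a : V}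
    (ha : ∀ j' : Fin d, ∃ (n : ℕ) (b b' : Fin n → V) (l : ℕ), (∀ k, σ (b k) = algebraMap U V ω ^ (j' : ℕ) * b k) ∧
      (∀ k, σ (b' k) = algebraMap U V ω ^ l * b' k) ∧ d ∣ (j' : ℕ) + l + gc ∧ ∑ k, b k * b' k = a)
    (h : StablyAnnihilates V c (ModuleCat.of V M)) (u : U) (hu : algebraMap U V u = a * c) :
    StablyAnnihilates U u (ModuleCat.of U N) := by
  obtain ⟨s, f, g, hgf⟩ := (stablyAnnihilates_iff_exists_linearMap c (ModuleCat.of V M)).mp h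
  obtain ⟨t, f', g', h'⟩ := exists_comp_eq_smul_id_fixed_of_isotypic σ hd hσd hfix hinj ω hωd horth hdU τ hτ
    hτd j hjinj hjτ hjsurj gc hc ha f g hgf u hu
  exact stablyAnnihilates_of_linearMap f' g' h'

/-- **Cyclic (μ_d) transfer, CA-layer form**: `c` stably annihilates the `V`-module `M`, `σ c = ω c`,
`σ aᵢ = ω aᵢ` (`i < d - 1`), `algebraMap U V u = c * ∏_{i<d-1} aᵢ` ⟹ `u` stably annihilates the invariant `U`-module
`N ≅ M^τ`. [folklore] -/
theorem StablyAnnihilates.fixed_of_cyclic (σ : V →ₐ[U] V) {d : ℕ} (hd : 0 < d) (hσd : σ ^ d = 1)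
    (hfix : ∀ v : V, σ v = v → ∃ u : U, algebraMap U V u = v) (hinj : Function.Injective (algebraMap U V))
    (ω : U) (hωd : ω ^ d = 1) (horth : ∀ m : ℕ, ¬ d ∣ m → ∑ i ∈ Finset.range d, ω ^ (m * i) = 0)
    (hdU : IsUnit ((d : ℕ) : U)) (τ : M →+ M) (hτ : ∀ (v : V) (m : M), τ (v • m) = σ v • τ m)
    (hτd : ∀ m, (⇑τ)^[d] m = m) (j : N →ₗ[U] M) (hjinj : Function.Injective j) (hjτ : ∀ n, τ (j n) = j n)
    (hjsurj : ∀ m, τ m = m → ∃ n, j n = m) {c : V} (hc : σ c = algebraMap U V ω * c) (a : ℕ → V)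
    (ha : ∀ i, i < d - 1 → σ (a i) = algebraMap U V ω * a i) (h : StablyAnnihilates V c (ModuleCat.of V M))
    (u : U) (hu : algebraMap U V u = c * ∏ i ∈ Finset.range (d - 1), a i) :
    StablyAnnihilates U u (ModuleCat.of U N) := by
  obtain ⟨s, f, g, hgf⟩ := (stablyAnnihilates_iff_exists_linearMap c (ModuleCat.of V M)).mp h
  obtain ⟨t, f', g', h'⟩ := exists_comp_eq_smul_id_fixed_of_cyclic σ hd hσd hfix hinj ω hωd horth hdU τ hτ hτd
    j hjinj hjτ hjsurj hc a ha f g hgf u hu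
  exact stablyAnnihilates_of_linearMap f' g' h'

/-- **The pure-power rule** (the form used at the Σ6 / C4 arrivals `U = V^{μ_d}`, `x = w^d`): if `w` stably
annihilates `M` over `V` and `σ w = ω w`, then `w ^ d` (as an element `u` of `U`) stably annihilates `N ≅ M^τ`
over `U`. [folklore] -/
theorem StablyAnnihilates.fixed_pow_of_cyclic (σ : V →ₐ[U] V) {d : ℕ} (hd : 0 < d) (hσd : σ ^ d = 1)
    (hfix : ∀ v : V, σ v = v → ∃ u : U, algebraMap U V u = v) (hinj : Function.Injective (algebraMap U V))
    (ω : U) (hωd : ω ^ d = 1) (horth : ∀ m : ℕ, ¬ d ∣ m → ∑ i ∈ Finset.range d, ω ^ (m * i) = 0)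
    (hdU : IsUnit ((d : ℕ) : U)) (τ : M →+ M) (hτ : ∀ (v : V) (m : M), τ (v • m) = σ v • τ m)
    (hτd : ∀ m, (⇑τ)^[d] m = m) (j : N →ₗ[U] M) (hjinj : Function.Injective j) (hjτ : ∀ n, τ (j n) = j n)
    (hjsurj : ∀ m, τ m = m → ∃ n, j n = m) {w : V} (hw : σ w = algebraMap U V ω * w)
    (h : StablyAnnihilates V w (ModuleCat.of V M)) (u : U) (hu : algebraMap U V u = w ^ d) :
    StablyAnnihilates U u (ModuleCat.of U N) := by
  refine StablyAnnihilates.fixed_of_cyclic σ hd hσd hfix hinj ω hωd horth hdU τ hτ hτd j hjinj hjτ hjsurj hw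
    (fun _ => w) (fun _ _ => hw) h u ?_
  rw [hu, Finset.prod_const, Finset.card_range, ← pow_succ', Nat.sub_add_cancel hd]

/-- **The pure-power rule with a primitive root of unity** (user-facing form over a domain `U`, e.g. a field
containing a primitive `d`-th root of unity with `d` invertible): `σ w = ω w`, `w ∈ s̲ann_V(M)` ⟹
`w^d ∈ s̲ann_U(M^τ)`. [folklore] -/
theorem StablyAnnihilates.fixed_pow_of_isPrimitiveRoot [IsDomain U] (σ : V →ₐ[U] V) {d : ℕ} (hd : 0 < d)
    (hσd : σ ^ d = 1) (hfix : ∀ v : V, σ v = v → ∃ u : U, algebraMap U V u = v)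
    (hinj : Function.Injective (algebraMap U V)) {ω : U} (hω : IsPrimitiveRoot ω d)
    (hdU : IsUnit ((d : ℕ) : U)) (τ : M →+ M) (hτ : ∀ (v : V) (m : M), τ (v • m) = σ v • τ m)
    (hτd : ∀ m, (⇑τ)^[d] m = m) (j : N →ₗ[U] M) (hjinj : Function.Injective j) (hjτ : ∀ n, τ (j n) = j n)
    (hjsurj : ∀ m, τ m = m → ∃ n, j n = m) {w : V} (hw : σ w = algebraMap U V ω * w)
    (h : StablyAnnihilates V w (ModuleCat.of V M)) (u : U) (hu : algebraMap U V u = w ^ d) :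
    StablyAnnihilates U u (ModuleCat.of U N) :=
  StablyAnnihilates.fixed_pow_of_cyclic σ hd hσd hfix hinj ω hω.pow_eq_one
    (sum_pow_mul_eq_zero_of_isPrimitiveRoot hω) hdU τ hτ hτd j hjinj hjτ hjsurj hw h u hu

end Summit.ResolutionOfSingularities.ResolutionOfSingularities.Theorems.HomologicalConductor.PersistenceCyclicTransferStable

end
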